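import Summits.CriticalPhenomena.PercolationContinuityZ3.Theorems.SahiMasterFamilySparseEndPartitions

/-!
# The sparse end of Sahi's hierarchy, II: all blocks allowed — `N_all(b) ≥ 0` by the peeling recursion

Support file of the master-family programme (crux `NoHeavyLowerTail`, stmt-CriticalPhenomena-4575; cell `prim-masterthm`, seat P4,
unit `prim-masterthm-p4-g4`).  Continues `SahiMasterFamilySparseEndPartitions` (set partitions `parts X`, the signed partition sums
`Z_Q`, `N_Q = −Z_Q`, the recursion `Z_rec` at the block of a distinguished point).  Seat document PROOF-SPARSE-END.md, Theorem 3 (A).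

* `Zall b X = Σ_{partitions of X} ∏_T (−(b_T−1)!)`, `Zall_rec`, `Zall_const_one` (all weights `1`: the value is `1, −1, 0` for
  `|X| = 0, 1, ≥ 2` — the classical `Σ_σ (−1)^{c(σ)} = 0`);
* `bw_split` — the factor split `(b_T − 1)! = ((b_s − 1) + Σ_{T∖s} b)·(b_T − 2)!`;
* **`Zall_nonpos`**: `Zall(b; X) ≤ 0` (`N_all(b) ≥ 0`) for nonempty `X` and weights `≥ 1`, by induction on `Σ_X b` through
  `N(b) = (b_s − 1)·N(b − e_s) + Σ_{t≠s} b_t·N(b^{(t→s)})` (merging `t` into `s`: `b_s ↦ b_s + b_t − 1` on `X ∖ {t}`) — the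
  Lieb–Sahi peeling recursion read at the sparse end for cylinder families.
HONEST FRAMING: elementary; [this work].
-/

namespace Summit.CriticalPhenomena.PercolationContinuityZ3.Theorems

namespace SahiSparseEnd

open Finset

variable {α : Type*} [DecidableEq α]

/-! ### All subsets allowed: `Zall` and its nonpositivity by induction on `Σ b` -/

/-- The unrestricted signed partition sum `Zall(b; X) = Σ_{partitions of X} ∏_T (−(b_T − 1)!)`. [this work] -/
def Zall (b : α → ℕ) (X : Finset α) : ℤ := ∑ P ∈ parts X, ∏ T ∈ P, (-bw b T)

/-- `Z_Q = Zall` when every subset of `X` is allowed. [this work] -/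
theorem Z_eq_Zall {Q : Finset (Finset α)} {b : α → ℕ} {X : Finset α} (hQ : ∀ A, A ⊆ X → A.Nonempty → A ∈ Q) :
    Z Q b X = Zall b X := by
  rw [Z, Zall]
  refine sum_congr ?_ fun _ _ => rfl
  ext P
  rw [mem_filter]
  exact ⟨fun h => h.1, fun h => ⟨h, fun T hT => hQ T ((mem_parts.1 h).1 T hT).2 ((mem_parts.1 h).1 T hT).1⟩⟩

/-- `Zall ∅ = 1`. [this work] -/
theorem Zall_empty (b : α → ℕ) : Zall b (∅ : Finset α) = 1 := by
  rw [Zall, parts_empty, sum_singleton, prod_empty]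

/-- `Zall` depends on `b` only through its values on `X`. [this work] -/
theorem Zall_congr {b b' : α → ℕ} {X : Finset α} (h : ∀ x ∈ X, b x = b' x) : Zall b X = Zall b' X := by
  refine sum_congr rfl fun P hP => prod_congr rfl fun T hT => ?_
  have hTX := ((mem_parts.1 hP).1 T hT).2
  rw [bw, bw, sum_congr rfl fun x hx => h x (hTX hx)]

/-- The recursion for `Zall` at the block of `s ∈ X`. [this work] -/
theorem Zall_rec (b : α → ℕ) {X : Finset α} {s : α} (hs : s ∈ X) :
    Zall b X = ∑ T ∈ X.powerset.filter (fun T => s ∈ T), (-bw b T) * Zall b (X \ T) := by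
  have h := Z_rec X.powerset b hs
  rw [Z_eq_Zall (fun A hA _ => mem_powerset.2 hA)] at h
  rw [h]
  refine sum_congr ?_ fun T hT => ?_
  · ext T; simp only [mem_filter, mem_powerset]; tauto
  · rw [mem_filter, mem_powerset] at hT
    rw [Z_eq_Zall (fun A hA _ => mem_powerset.2 (hA.trans sdiff_subset))]

/-- Splitting the block weight: for `s ∈ T` with `b s ≥ 1`… precisely, if `Σ_T b ≥ 2` then
`(Σ_T b − 1)! = ((b s − 1) + Σ_{T∖s} b) · (Σ_T b − 2)!` and `(Σ_T b − 2)! = bw (b with b s ↦ b s − 1) T`. [this work] -/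
theorem bw_split (b : α → ℕ) {T : Finset α} {s : α} (hs : s ∈ T) (h2 : 2 ≤ ∑ x ∈ T, b x) (h1 : 1 ≤ b s) :
    bw b T = (((b s - 1 : ℕ) : ℤ) + ∑ x ∈ T.erase s, (b x : ℤ)) * bw (Function.update b s (b s - 1)) T := by
  have hsum : ∑ x ∈ T, b x = b s + ∑ x ∈ T.erase s, b x := by rw [← add_sum_erase T b hs]
  have hsum' : ∑ x ∈ T, Function.update b s (b s - 1) x = (b s - 1) + ∑ x ∈ T.erase s, b x := by
    rw [← add_sum_erase T _ hs, Function.update_self]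
    congr 1
    exact sum_congr rfl fun x hx => by rw [Function.update_of_ne (ne_of_mem_erase hx)]
  rw [bw, bw, hsum', hsum]
  have e : b s + ∑ x ∈ T.erase s, b x - 1 = (b s - 1 + ∑ x ∈ T.erase s, b x - 1) + 1 := by omega
  rw [e, Nat.factorial_succ]
  push_cast
  have : ((b s - 1 + ∑ x ∈ T.erase s, b x - 1 : ℕ) : ℤ) + 1 = ((b s - 1 : ℕ) : ℤ) + ∑ x ∈ T.erase s, (b x : ℤ) := by
    have h3 : 1 ≤ b s - 1 + ∑ x ∈ T.erase s, b x := by omega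
    rw [Nat.cast_sub h3]
    push_cast
    ring
  rw [this]

/-- With all weights `1`: `Zall(X) = 1, −1, 0` according as `|X| = 0, 1, ≥ 2`. [this work] -/
theorem Zall_const_one {X : Finset α} {b : α → ℕ} (hb : ∀ x ∈ X, b x = 1) :
    Zall b X = if X = ∅ then 1 else if X.card = 1 then -1 else 0 := by
  induction X using Finset.strongInduction with
  | H X ih =>
    rcases X.eq_empty_or_nonempty with rfl | ⟨s, hs⟩
    · rw [Zall_empty]; simp
    rw [if_neg (nonempty_iff_ne_empty.1 ⟨s, hs⟩), Zall_rec b hs]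
    -- the value of each term
    have hbw : ∀ T, T ⊆ X → bw b T = ((T.card - 1).factorial : ℤ) := by
      intro T hT
      rw [bw, sum_congr rfl fun x hx => hb x (hT hx), sum_const, smul_eq_mul, mul_one]
    have hterm : ∀ T ∈ X.powerset.filter (fun T => s ∈ T), (-bw b T) * Zall b (X \ T) =
        (if T = X then -(((X.card - 1).factorial : ℕ) : ℤ) else 0) +
          (if (X \ T).card = 1 then (((X.card - 2).factorial : ℕ) : ℤ) else 0) := by
      intro T hT
      rw [mem_filter, mem_powerset] at hT
      have hTX := hT.1
      by_cases hTeq : T = X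
      · subst hTeq
        rw [Finset.sdiff_self, Zall_empty, hbw T subset_rfl, if_pos rfl, card_empty, if_neg (by norm_num)]
        simp
      · have hssub : X \ T ⊂ X := sdiff_ssubset hTX ⟨s, hT.2⟩
        have hne : X \ T ≠ ∅ := by
          intro h
          rw [sdiff_eq_empty_iff_subset] at h
          exact hTeq (subset_antisymm hTX h)
        rw [ih _ hssub (fun x hx => hb x (sdiff_subset hx)), if_neg hne, hbw T hTX, if_neg hTeq, zero_add]
        by_cases h1 : (X \ T).card = 1
        · rw [if_pos h1, if_pos h1]
          have : T.card - 1 = X.card - 2 := by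
            have := card_sdiff_add_card_eq_card hTX; omega
          rw [this]; ring
        · rw [if_neg h1, if_neg h1, mul_zero]
    rw [sum_congr rfl hterm, sum_add_distrib, sum_ite_eq' (X.powerset.filter fun T => s ∈ T) X, if_pos (by
      rw [mem_filter, mem_powerset]; exact ⟨subset_rfl, hs⟩)]
    rw [← sum_filter, filter_filter, sum_const, nsmul_eq_mul]
    -- the number of `T ∋ s` with `|X \ T| = 1` is `|X| − 1`
    have hcount : (X.powerset.filter (fun T => s ∈ T ∧ (X \ T).card = 1)).card = X.card - 1 := by
      rw [← card_erase_of_mem hs]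
      symm
      refine card_bij (fun y _ => X.erase y) (fun y hy => ?_) (fun y hy y' hy' h => ?_) (fun T hT => ?_)
      · have hyX : y ∈ X := mem_of_mem_erase hy
        have hXy : X \ X.erase y = {y} := by
          ext x
          simp only [mem_sdiff, mem_erase, mem_singleton, not_and]
          constructor
          · rintro ⟨hx, h⟩
            by_contra hxy
            exact hxy (by
              by_contra hxy'
              exact absurd hx (h hxy'))
          · rintro rfl
            exact ⟨hyX, fun h => absurd rfl h⟩
        rw [mem_filter, mem_powerset, mem_erase, hXy, card_singleton]
        exact ⟨erase_subset _ _, ⟨(ne_of_mem_erase hy).symm, hs⟩, rfl⟩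
      · by_contra hne
        have hy'X : y' ∈ X := mem_of_mem_erase hy'
        have hmem : y' ∈ X.erase y := mem_erase.2 ⟨fun e => hne e.symm, hy'X⟩
        rw [h] at hmem
        exact (notMem_erase y' X) hmem
      · rw [mem_filter, mem_powerset] at hT
        obtain ⟨hTX, hsT, h1⟩ := hT
        obtain ⟨y, hy⟩ := card_eq_one.1 h1
        have hyX : y ∈ X \ T := hy ▸ mem_singleton_self y
        refine ⟨y, mem_erase.2 ⟨fun e => (mem_sdiff.1 hyX).2 (e ▸ hsT), (mem_sdiff.1 hyX).1⟩, ?_⟩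
        ext x
        rw [mem_erase]
        constructor
        · rintro ⟨hxy, hxX⟩
          by_contra hxT
          have : x ∈ X \ T := mem_sdiff.2 ⟨hxX, hxT⟩
          rw [hy, mem_singleton] at this
          exact hxy this
        · intro hxT
          exact ⟨fun e => (mem_sdiff.1 hyX).2 (e ▸ hxT), hTX hxT⟩
    rw [hcount]
    by_cases hX1 : X.card = 1
    · rw [if_pos hX1, hX1]; simp
    · rw [if_neg hX1]
      have h2 : 2 ≤ X.card := by have := card_pos.2 ⟨s, hs⟩; omega
      obtain ⟨n, hn⟩ : ∃ n, X.card = n + 2 := ⟨X.card - 2, by omega⟩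
      rw [hn]
      simp only [Nat.add_sub_cancel, show n + 2 - 1 = n + 1 by omega, Nat.factorial_succ]
      push_cast
      ring

/-- The terms `T ∋ s, t` of the recursion: substituting `T = insert t T'`. [this work] -/
theorem sum_filter_mem_mem_eq {X : Finset α} {s t : α} (ht : t ∈ X) (hts : t ≠ s) (g : Finset α → ℤ) :
    ∑ T ∈ X.powerset.filter (fun T => s ∈ T ∧ t ∈ T), g T =
      ∑ T' ∈ (X.erase t).powerset.filter (fun T' => s ∈ T'), g (insert t T') := by
  refine sum_nbij' (fun T => T.erase t) (fun T' => insert t T') ?_ ?_ ?_ ?_ ?_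
  · intro T hT
    rw [mem_filter, mem_powerset] at hT ⊢
    exact ⟨erase_subset_erase t hT.1, mem_erase.2 ⟨hts.symm, hT.2.1⟩⟩
  · intro T' hT'
    rw [mem_filter, mem_powerset] at hT' ⊢
    refine ⟨insert_subset ht (hT'.1.trans (erase_subset _ _)), mem_insert_of_mem hT'.2, mem_insert_self _ _⟩
  · intro T hT
    rw [mem_filter] at hT
    exact insert_erase hT.2.2
  · intro T' hT'
    rw [mem_filter, mem_powerset] at hT'
    exact erase_insert fun h => (notMem_erase t X) (hT'.1 h)
  · intro T hT
    rw [mem_filter] at hT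
    rw [insert_erase hT.2.2]

/-- **All subsets: `Zall(b; X) ≤ 0` for nonempty `X` and weights `≥ 1`** (i.e. `N_all(b) ≥ 0`), by induction on `Σ_X b` through
`N(b) = (b_s − 1) N(b − e_s) + Σ_t b_t N(b^{(t→s)})`. [this work] -/
theorem Zall_nonpos : ∀ (n : ℕ) (X : Finset α) (b : α → ℕ), (∀ x, 1 ≤ b x) → ∑ x ∈ X, b x = n → X.Nonempty →
    Zall b X ≤ 0 := by
  intro n
  induction n using Nat.strong_induction_on with
  | _ n ih =>
    intro X b hb hn hX
    by_cases hone : ∀ x ∈ X, b x = 1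
    · rw [Zall_const_one hone, if_neg (nonempty_iff_ne_empty.1 hX)]
      split_ifs <;> norm_num
    push Not at hone
    obtain ⟨s, hs, hbs⟩ := hone
    have hbs2 : 2 ≤ b s := by have := hb s; omega
    have hn1 : n - 1 < n := by
      have : 1 ≤ n := by rw [← hn]; exact le_trans (hb s) (single_le_sum (fun x _ => Nat.zero_le _) hs)
      omega
    -- the weight with `b s ↦ b s − 1`
    set b' : α → ℕ := Function.update b s (b s - 1) with hb'def
    have hb's : b' s = b s - 1 := by rw [hb'def, Function.update_self]
    have hb'x : ∀ x, x ≠ s → b' x = b x := fun x hx => by rw [hb'def, Function.update_of_ne hx]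
    have hb' : ∀ x, 1 ≤ b' x := fun x => by
      by_cases hx : x = s
      · rw [hx, hb's]; omega
      · rw [hb'x x hx]; exact hb x
    -- expand `Zall b X` at `s` and split the block weights
    have hrec := Zall_rec b hs
    have hsplit : ∀ T ∈ X.powerset.filter (fun T => s ∈ T), (-bw b T) * Zall b (X \ T) =
        ((b s - 1 : ℕ) : ℤ) * ((-bw b' T) * Zall b' (X \ T)) +
          ∑ t ∈ T.erase s, (b t : ℤ) * ((-bw b' T) * Zall b' (X \ T)) := by
      intro T hT
      rw [mem_filter, mem_powerset] at hT
      have h2 : 2 ≤ ∑ x ∈ T, b x := le_trans hbs2 (single_le_sum (fun x _ => Nat.zero_le _) hT.2)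
      have hZ : Zall b (X \ T) = Zall b' (X \ T) :=
        Zall_congr fun x hx => (hb'x x fun e => (mem_sdiff.1 hx).2 (e ▸ hT.2)).symm
      rw [bw_split b hT.2 h2 (hb s), hZ, ← sum_mul]
      ring
    rw [sum_congr rfl hsplit, sum_add_distrib, ← mul_sum, ← Zall_rec b' hs] at hrec
    -- first piece: `(b s − 1) · Zall b' X ≤ 0`
    have eA : ∑ x ∈ X, b x = b s + ∑ x ∈ X.erase s, b x := (add_sum_erase X b hs).symm
    have eB : ∑ x ∈ X, b' x = (b s - 1) + ∑ x ∈ X.erase s, b x := by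
      rw [← add_sum_erase X b' hs, hb's]
      congr 1
      exact sum_congr rfl fun x hx => hb'x x (ne_of_mem_erase hx)
    have hsum' : ∑ x ∈ X, b' x = n - 1 := by omega
    have h1 : Zall b' X ≤ 0 := ih (n - 1) hn1 X b' hb' hsum' hX
    -- second piece: swap the sums, substitute `T = insert t T'`, recognise `Zall b''_t (X.erase t)`
    have hswap : ∑ T ∈ X.powerset.filter (fun T => s ∈ T), ∑ t ∈ T.erase s, (b t : ℤ) * ((-bw b' T) * Zall b' (X \ T)) =
        ∑ t ∈ X.erase s, (b t : ℤ) * ∑ T ∈ X.powerset.filter (fun T => s ∈ T ∧ t ∈ T), (-bw b' T) * Zall b' (X \ T) := by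
      rw [sum_comm' (t' := X.erase s) (s' := fun t => X.powerset.filter (fun T => s ∈ T ∧ t ∈ T))]
      · exact sum_congr rfl fun t _ => by rw [mul_sum]
      · intro T t
        simp only [mem_filter, mem_powerset, mem_erase]
        constructor
        · rintro ⟨⟨hTX, hsT⟩, hts, htT⟩; exact ⟨⟨hTX, hsT, htT⟩, hts, hTX htT⟩
        · rintro ⟨⟨hTX, hsT, htT⟩, hts, -⟩; exact ⟨⟨hTX, hsT⟩, hts, htT⟩
    have h2 : ∀ t ∈ X.erase s,
        ∑ T ∈ X.powerset.filter (fun T => s ∈ T ∧ t ∈ T), (-bw b' T) * Zall b' (X \ T) ≤ 0 := by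
      intro t ht
      have hts : t ≠ s := ne_of_mem_erase ht
      have htX : t ∈ X := mem_of_mem_erase ht
      have hsX : s ∈ X.erase t := mem_erase.2 ⟨hts.symm, hs⟩
      -- the merged weight `b s ↦ b s + b t − 1`
      set b'' : α → ℕ := Function.update b s (b s + b t - 1) with hb''def
      have hb''s : b'' s = b s + b t - 1 := by rw [hb''def, Function.update_self]
      have hb''x : ∀ x, x ≠ s → b'' x = b x := fun x hx => by rw [hb''def, Function.update_of_ne hx]
      have hb'' : ∀ x, 1 ≤ b'' x := fun x => by
        by_cases hx : x = s
        · rw [hx, hb''s]; omega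
        · rw [hb''x x hx]; exact hb x
      rw [sum_filter_mem_mem_eq htX hts]
      have hterm : ∀ T' ∈ (X.erase t).powerset.filter (fun T' => s ∈ T'),
          (-bw b' (insert t T')) * Zall b' (X \ insert t T') = (-bw b'' T') * Zall b'' ((X.erase t) \ T') := by
        intro T' hT'
        rw [mem_filter, mem_powerset] at hT'
        have htT' : t ∉ T' := fun h => (notMem_erase t X) (hT'.1 h)
        have hset : X \ insert t T' = (X.erase t) \ T' := by
          ext x; simp only [mem_sdiff, mem_insert, mem_erase, not_or]; tauto
        have hS1 : ∑ x ∈ insert t T', b' x = (b s - 1) + b t + ∑ x ∈ T'.erase s, b x := by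
          rw [sum_insert htT', ← add_sum_erase T' b' hT'.2, hb's, hb'x t hts,
            sum_congr rfl fun x hx => hb'x x (ne_of_mem_erase hx)]
          ring
        have hS2 : ∑ x ∈ T', b'' x = (b s + b t - 1) + ∑ x ∈ T'.erase s, b x := by
          rw [← add_sum_erase T' b'' hT'.2, hb''s, sum_congr rfl fun x hx => hb''x x (ne_of_mem_erase hx)]
        have hbw : bw b' (insert t T') = bw b'' T' := by
          rw [bw, bw, hS1, hS2]
          have := hb s
          congr 2
          omega
        have hZ : Zall b' (X \ insert t T') = Zall b'' ((X.erase t) \ T') := by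
          rw [hset]
          refine Zall_congr fun x hx => ?_
          have hxs : x ≠ s := fun e => (mem_sdiff.1 hx).2 (e ▸ hT'.2)
          rw [hb'x x hxs, hb''x x hxs]
        rw [hbw, hZ]
      rw [sum_congr rfl hterm, ← Zall_rec b'' hsX]
      have eA : ∑ x ∈ X, b x = b t + (b s + ∑ x ∈ (X.erase t).erase s, b x) := by
        rw [← add_sum_erase X b htX, ← add_sum_erase (X.erase t) b hsX]
      have eB : ∑ x ∈ X.erase t, b'' x = (b s + b t - 1) + ∑ x ∈ (X.erase t).erase s, b x := by
        rw [← add_sum_erase (X.erase t) b'' hsX, hb''s, sum_congr rfl fun x hx => hb''x x (ne_of_mem_erase hx)]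
      have hsum'' : ∑ x ∈ X.erase t, b'' x = n - 1 := by have := hb s; have := hb t; omega
      exact ih (n - 1) hn1 (X.erase t) b'' hb'' hsum'' ⟨s, hsX⟩
    -- assemble
    rw [hrec, hswap]
    have hA : ((b s - 1 : ℕ) : ℤ) * Zall b' X ≤ 0 := mul_nonpos_of_nonneg_of_nonpos (by positivity) h1
    have hB : ∑ t ∈ X.erase s, (b t : ℤ) * ∑ T ∈ X.powerset.filter (fun T => s ∈ T ∧ t ∈ T),
        (-bw b' T) * Zall b' (X \ T) ≤ 0 :=
      sum_nonpos fun t ht => mul_nonpos_of_nonneg_of_nonpos (by positivity) (h2 t ht)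
    linarith

end SahiSparseEnd

end Summit.CriticalPhenomena.PercolationContinuityZ3.Theorems
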